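import Literature.AlgebraicGeometry.Motives.UniversalHyperplaneSectionFamilyGoodLocus
import Literature.AlgebraicGeometry.Motives.FiberNetExistence
import Literature.AlgebraicGeometry.Resolution.SmoothOfRegularFibre
import HarnessLib

/-!
# The family of hyperplane sections of the fibres of a smooth projective family, IV: the slice over one fibre

Topic `Literature/AlgebraicGeometry/Motives` (theorems only). For `g = (toX ≫ f, proj) : 𝒴 ⟶ S × (ℙᴺ)^*`
(`Motives/UniversalHyperplaneSectionFamily`, `…Flat`, `…GoodLocus`) and a complex point `t` of `S`:

* `map_slice`, `isPullback_slice`, `isPullback_familyPullback_slice` — the slice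
  `σ_t : (ℙᴺ)^* ⟶ S × (ℙᴺ)^*`, `H ↦ (t, H)`, a base change of the point `t`;
* `smoothOfRelativeDimension_slicePullback_hom`, `mem_smoothLocus_slicePullback_snd`,
  `exists_open_forall_smooth_fiberOver_slice` — **generic smoothness of the sections of ONE fibre**: the
  slice family `𝒴_t ⟶ (ℙᴺ)^*` is smooth over `ℂ`, smooth at the points over the generic point, hence
  there is a non-empty open `U ⊆ (ℙᴺ)^*` all of whose complex points `H` have `X_t ∩ H` (the fibre of
  `g` over `(t, H)`) smooth of dimension `n`;
* `isPullback_fiberι`, `exists_slicePullback_hom_fiberOver` — `𝒴_t = 𝒴 ×_𝒳 X_t ⟶ X_t` is a base change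
  of the smooth `toX`, hence flat.

## References

* [VoisinHodgeII2003] C. Voisin, Hodge Theory and Complex Algebraic Geometry II, CUP 2003, §2.1.1 and §3.2.2.
* [GortzWedhorn2020] U. Görtz, T. Wedhorn, Algebraic Geometry I, 2nd ed. (2020).
-/

noncomputable section

open CategoryTheory CategoryTheory.Limits AlgebraicGeometry TopologicalSpace MonoidalCategory
  CartesianMonoidalCategory
open Literature.AlgebraicGeometry.HodgeTheory
open Literature.AlgebraicGeometry.Motives.UniversalHyperplaneSection

universe u

namespace Literature.AlgebraicGeometry.Motives.SectionFamily

/-! ### The slice `{t} × (ℙᴺ)^*` and generic smoothness of the sections of ONE fibre -/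
section Slice

variable {n N d : ℕ} {𝒳 S : SchemeOver ℂ} (f : 𝒳 ⟶ S) (e : 𝒳 ⟶ projectiveSpace N ℂ)
  (t : ComplexPoints S)

/-- The slice `H ↦ (t, H)` on complex points. [folklore] -/
theorem map_slice (H : ComplexPoints (dualProjectiveSpace N ℂ)) :
    AlgPoints.map (CartesianMonoidalCategory.lift (toSpecOver (dualProjectiveSpace N ℂ) ≫ t)
        (𝟙 (dualProjectiveSpace N ℂ))) H = CartesianMonoidalCategory.lift t H := by
  rw [AlgPoints.map_apply, CartesianMonoidalCategory.comp_lift, Category.comp_id, ← Category.assoc,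
    LinearSectionNet.eq_id_of_specOver_self (H ≫ toSpecOver _), Category.id_comp]

/-- **`{t} × (ℙᴺ)^* = (S × (ℙᴺ)^*) ×_S {t}`**: the slice `H ↦ (t, H)` is the base change of the
point `t` along the projection `S × (ℙᴺ)^* ⟶ S` (a cone `(u, v)` with `u ≫ pr_S = v ≫ t` factors
uniquely as `u ≫ pr_{(ℙᴺ)^*}`). [folklore] -/
theorem isPullback_slice :
    IsPullback (CartesianMonoidalCategory.lift (toSpecOver (dualProjectiveSpace N ℂ) ≫ t) (𝟙 (dualProjectiveSpace N ℂ)))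
      (toSpecOver (dualProjectiveSpace N ℂ)) (fst S (dualProjectiveSpace N ℂ)) t := by
  -- adapted from `Motives.isPullback_snd_whiskerLeft`
  refine IsPullback.of_isLimit' ⟨by rw [CartesianMonoidalCategory.lift_fst]⟩ (PullbackCone.IsLimit.mk _
    (fun c => c.fst ≫ snd S (dualProjectiveSpace N ℂ))
    (fun c => ?_) (fun c => Literature.AlgebraicGeometry.Motives.eq_toSpecOver _ |>.trans
      (Literature.AlgebraicGeometry.Motives.eq_toSpecOver _).symm) (fun c m h₁ _ => ?_))
  · refine CartesianMonoidalCategory.hom_ext _ _ ?_ ?_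
    · rw [Category.assoc, CartesianMonoidalCategory.lift_fst, ← Category.assoc,
        Literature.AlgebraicGeometry.Motives.eq_toSpecOver ((c.fst ≫ snd S _) ≫ toSpecOver _),
        ← Literature.AlgebraicGeometry.Motives.eq_toSpecOver c.snd]
      exact c.condition.symm
    · rw [Category.assoc, CartesianMonoidalCategory.lift_snd, Category.comp_id]
  · rw [← h₁, Category.assoc, CartesianMonoidalCategory.lift_snd, Category.comp_id]

/-- **The family of sections of the fibre `X_t`, `𝒴_t = 𝒴 ×_{S × (ℙᴺ)^*} ({t} × (ℙᴺ)^*)`, is the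
fibre of `𝒴 ⟶ S` over `t`** (pasting the base-change square of `g` along the slice with
`isPullback_slice`). [folklore] -/
theorem isPullback_familyPullback_slice :
    IsPullback
      (familyPullback.fst (CartesianMonoidalCategory.lift (toX N e ≫ f) (proj N e))
        (CartesianMonoidalCategory.lift (toSpecOver (dualProjectiveSpace N ℂ) ≫ t) (𝟙 (dualProjectiveSpace N ℂ))))
      (familyPullback.snd (CartesianMonoidalCategory.lift (toX N e ≫ f) (proj N e))
        (CartesianMonoidalCategory.lift (toSpecOver (dualProjectiveSpace N ℂ) ≫ t) (𝟙 (dualProjectiveSpace N ℂ))) ≫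
        toSpecOver (dualProjectiveSpace N ℂ))
      (toX N e ≫ f) t := by
  have h := (familyPullback.isPullback (CartesianMonoidalCategory.lift (toX N e ≫ f) (proj N e))
    (CartesianMonoidalCategory.lift (toSpecOver (dualProjectiveSpace N ℂ) ≫ t) (𝟙 (dualProjectiveSpace N ℂ)))).paste_vert
    (isPullback_slice t)
  rwa [sectionFamily_fst] at h

/-- `𝒴_t ⟶ Spec ℂ` is smooth of relative dimension `N - 1 + (n + 1)` (base change of the smooth
`𝒴 ⟶ S`). [folklore] -/
theorem smoothOfRelativeDimension_slicePullback_hom (hf : IsSmoothProjectiveFamily f (n + 1))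
    [IsAffineHom e.left] [Smooth S.hom] [IrreducibleSpace S.left] :
    SmoothOfRelativeDimension (N - 1 + (n + 1))
      (familyPullback (CartesianMonoidalCategory.lift (toX N e ≫ f) (proj N e))
        (CartesianMonoidalCategory.lift (toSpecOver (dualProjectiveSpace N ℂ) ≫ t) (𝟙 (dualProjectiveSpace N ℂ)))).hom := by
  haveI := hf.smoothOfRelativeDimension
  haveI := isIntegral_total_left f hf
  haveI : IsReduced 𝒳.left := inferInstance
  haveI := UniversalHyperplaneSection.smoothOfRelativeDimension_toX_left e
  have h1 : SmoothOfRelativeDimension (N - 1 + (n + 1)) (toX N e ≫ f).left := by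
    rw [Over.comp_left]; infer_instance
  haveI := smoothOfRelativeDimension_isStableUnderBaseChange (n := N - 1 + (n + 1))
  have h2 : SmoothOfRelativeDimension (N - 1 + (n + 1))
      (familyPullback.snd (CartesianMonoidalCategory.lift (toX N e ≫ f) (proj N e))
        (CartesianMonoidalCategory.lift (toSpecOver (dualProjectiveSpace N ℂ) ≫ t) (𝟙 (dualProjectiveSpace N ℂ))) ≫
        toSpecOver (dualProjectiveSpace N ℂ)).left :=
    MorphismProperty.of_isPullback (P := @SmoothOfRelativeDimension (N - 1 + (n + 1)))
      ((isPullback_familyPullback_slice f e t).map (Over.forget _)) h1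
  haveI := isIso_specOver_self_hom (k := ℂ)
  rw [← Over.w (familyPullback.snd (CartesianMonoidalCategory.lift (toX N e ≫ f) (proj N e))
    (CartesianMonoidalCategory.lift (toSpecOver (dualProjectiveSpace N ℂ) ≫ t) (𝟙 (dualProjectiveSpace N ℂ))) ≫
    toSpecOver (dualProjectiveSpace N ℂ))]
  have h3 : SmoothOfRelativeDimension (N - 1 + (n + 1) + 0)
      ((familyPullback.snd (CartesianMonoidalCategory.lift (toX N e ≫ f) (proj N e))
        (CartesianMonoidalCategory.lift (toSpecOver (dualProjectiveSpace N ℂ) ≫ t) (𝟙 (dualProjectiveSpace N ℂ))) ≫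
        toSpecOver (dualProjectiveSpace N ℂ)).left ≫ (specOver ℂ ℂ).hom) := by
    haveI := h2; infer_instance
  exact h3

/-- **Generic smoothness of the sections of one fibre**: every point of `𝒴_t` over the generic point
`η` of `(ℙᴺ)^*` is a smooth point of `g_t : 𝒴_t ⟶ (ℙᴺ)^*` — `𝒪_{(ℙᴺ)^*, η}` is a field of
characteristic `0` (so `g_t` is flat there, with perfect residue field) and the fibre ring is the
regular local ring `𝒪_{𝒴_t, y}` of the smooth `𝒴_t` (Stacks 01V8 in the regular-fibre form
`Resolution.formallySmooth_of_flat_of_isRegularLocalRing_fiber`; Hartshorne III Cor. 10.7).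
[cite: Hartshorne1977, III Cor. 10.7] [cite: StacksProject, Tag 01V8] -/
theorem mem_smoothLocus_slicePullback_snd (hf : IsSmoothProjectiveFamily f (n + 1))
    [IsAffineHom e.left] [Smooth S.hom] [IrreducibleSpace S.left]
    {y : (familyPullback (CartesianMonoidalCategory.lift (toX N e ≫ f) (proj N e))
        (CartesianMonoidalCategory.lift (toSpecOver (dualProjectiveSpace N ℂ) ≫ t) (𝟙 (dualProjectiveSpace N ℂ)))).left}
    (hy : (familyPullback.snd (CartesianMonoidalCategory.lift (toX N e ≫ f) (proj N e))
        (CartesianMonoidalCategory.lift (toSpecOver (dualProjectiveSpace N ℂ) ≫ t) (𝟙 (dualProjectiveSpace N ℂ)))).left.base y =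
        genericPoint (dualProjectiveSpace N ℂ).left) :
    ((familyPullback.snd (CartesianMonoidalCategory.lift (toX N e ≫ f) (proj N e))
        (CartesianMonoidalCategory.lift (toSpecOver (dualProjectiveSpace N ℂ) ≫ t)
          (𝟙 (dualProjectiveSpace N ℂ)))).left.stalkMap y).hom.FormallySmooth := by
  -- adapted from `FiberNet.mem_smoothLocus_of_apply_eq_genericPoint`
  set π := familyPullback.snd (CartesianMonoidalCategory.lift (toX N e ≫ f) (proj N e))
    (CartesianMonoidalCategory.lift (toSpecOver (dualProjectiveSpace N ℂ) ≫ t) (𝟙 (dualProjectiveSpace N ℂ))) with hπ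
  haveI : LocallyOfFiniteType π.left := by
    haveI := smoothOfRelativeDimension_slicePullback_hom f e t hf
    haveI : LocallyOfFiniteType (π.left ≫ (dualProjectiveSpace N ℂ).hom) := by
      rw [Over.w π]
      haveI : Smooth (familyPullback (CartesianMonoidalCategory.lift (toX N e ≫ f) (proj N e))
        (CartesianMonoidalCategory.lift (toSpecOver (dualProjectiveSpace N ℂ) ≫ t)
          (𝟙 (dualProjectiveSpace N ℂ)))).hom := SmoothOfRelativeDimension.smooth (N - 1 + (n + 1)) _
      infer_instance
    exact locallyOfFiniteType_of_comp _ (dualProjectiveSpace N ℂ).hom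
  set R := (dualProjectiveSpace N ℂ).left.presheaf.stalk (π.left.base y) with hR
  set A := (familyPullback (CartesianMonoidalCategory.lift (toX N e ≫ f) (proj N e))
    (CartesianMonoidalCategory.lift (toSpecOver (dualProjectiveSpace N ℂ) ≫ t)
      (𝟙 (dualProjectiveSpace N ℂ)))).left.presheaf.stalk y with hA
  letI : Algebra R A := (π.left.stalkMap y).hom.toAlgebra
  haveI : IsLocalHom (algebraMap R A) := inferInstanceAs (IsLocalHom (π.left.stalkMap y).hom)
  haveI : Algebra.EssFiniteType R A := LocallyOfFiniteType.stalkMap π.left y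
  have hRf : IsField R := by
    rw [hR, hy]
    exact Field.toIsField (dualProjectiveSpace N ℂ).left.functionField
  haveI : Module.Flat R A := RingHom.Flat.of_isField hRf _
  haveI : IsNoetherianRing R := by
    letI := hRf.toField
    infer_instance
  haveI : CharZero R := charZero_stalk_of_charZero (dualProjectiveSpace N ℂ) _
  haveI : CharZero (IsLocalRing.ResidueField R) :=
    (RingHom.charZero_iff (by
      letI := hRf.toField
      exact (algebraMap R (IsLocalRing.ResidueField R)).injective)).mp inferInstance
  haveI := smoothOfRelativeDimension_slicePullback_hom f e t hf
  haveI : IsRegularLocalRing A :=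
    isRegularLocalRing_stalk_of_smoothOfRelativeDimension
      (familyPullback (CartesianMonoidalCategory.lift (toX N e ≫ f) (proj N e))
        (CartesianMonoidalCategory.lift (toSpecOver (dualProjectiveSpace N ℂ) ≫ t)
          (𝟙 (dualProjectiveSpace N ℂ)))).hom (N - 1 + (n + 1)) y
  have hmax : IsLocalRing.maximalIdeal R = ⊥ := by
    letI := hRf.toField
    exact IsLocalRing.maximalIdeal_eq_bot (R := R)
  have e₁ : (A ⧸ (IsLocalRing.maximalIdeal R).map (algebraMap R A)) ≃+*
      TensorProduct R (IsLocalRing.ResidueField R) A :=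
    (Algebra.TensorProduct.quotIdealMapEquivTensorQuot A (IsLocalRing.maximalIdeal R)).toRingEquiv.trans
      (Algebra.TensorProduct.comm R A (IsLocalRing.ResidueField R)).toRingEquiv
  have e₀ : A ≃+* (A ⧸ (IsLocalRing.maximalIdeal R).map (algebraMap R A)) :=
    (RingEquiv.quotientBot A).symm.trans (Ideal.quotEquivOfEq (by rw [hmax, Ideal.map_bot]))
  have hreg : IsRegularLocalRing (TensorProduct R (IsLocalRing.ResidueField R) A) :=
    IsRegularLocalRing.of_ringEquiv (e₀.trans e₁)
  have hfs : Algebra.FormallySmooth R A :=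
    Literature.AlgebraicGeometry.Resolution.formallySmooth_of_flat_of_isRegularLocalRing_fiber R A hreg
  exact hfs

/-- **The sections of one fibre are smooth of dimension `n` over a non-empty open of `(ℙᴺ)^*`**
(generic smoothness in characteristic `0`, Hartshorne III Cor. 10.7, for the family
`g_t : 𝒴_t ⟶ (ℙᴺ)^*` of hyperplane sections of `X_t`): there is a non-empty open `U ⊆ (ℙᴺ)^*` such
that for every complex point `H` of `U` the fibre of `g` over `(t, H)` — the hyperplane section
`X_t ∩ H` — is smooth of relative dimension `n`. [cite: Hartshorne1977, III Cor. 10.7]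
[cite: VoisinHodgeII2003, §3.2.2] -/
theorem exists_open_forall_smooth_fiberOver_slice (hf : IsSmoothProjectiveFamily f (n + 1))
    [IrreducibleSpace S.left] [SmoothOfRelativeDimension d S.hom] [IsAffine S.left] [IsAffineHom e.left]
    (hN : 2 ≤ N) :
    ∃ U : (dualProjectiveSpace N ℂ).left.Opens, (U : Set (dualProjectiveSpace N ℂ).left).Nonempty ∧
      ∀ H : ComplexPoints (dualProjectiveSpace N ℂ), H.pt ∈ U →
        SmoothOfRelativeDimension n
          (fiberOver (CartesianMonoidalCategory.lift (toX N e ≫ f) (proj N e))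
            (CartesianMonoidalCategory.lift t H)).hom := by
  haveI : Smooth S.hom := SmoothOfRelativeDimension.smooth d _
  set g := CartesianMonoidalCategory.lift (toX N e ≫ f) (proj N e) with hg
  set σ : dualProjectiveSpace N ℂ ⟶ S ⊗ dualProjectiveSpace N ℂ :=
    CartesianMonoidalCategory.lift (toSpecOver (dualProjectiveSpace N ℂ) ≫ t) (𝟙 (dualProjectiveSpace N ℂ)) with hσ
  set π := familyPullback.snd g σ with hπ
  haveI := smoothOfRelativeDimension_slicePullback_hom f e t hf
  haveI : SmoothOfRelativeDimension (n + N) (familyPullback g σ).hom := by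
    rw [show n + N = N - 1 + (n + 1) by omega]; infer_instance
  haveI := smoothOfRelativeDimension_dualProjectiveSpace_hom (N := N)
  haveI : LocallyOfFiniteType π.left := by
    haveI : LocallyOfFiniteType (π.left ≫ (dualProjectiveSpace N ℂ).hom) := by
      rw [Over.w π]
      haveI : Smooth (familyPullback g σ).hom := SmoothOfRelativeDimension.smooth (n + N) _
      infer_instance
    exact locallyOfFiniteType_of_comp _ (dualProjectiveSpace N ℂ).hom
  haveI : IsLocallyNoetherian (dualProjectiveSpace N ℂ).left :=
    IsSmoothProjective.isLocallyNoetherian_holds (isSmoothProjective_projectiveSpace_holds ℂ N)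
  haveI : LocallyOfFinitePresentation π.left := by
    -- adapted from `HodgeTheory.locallyOfFinitePresentation_of_isLocallyNoetherian` (AlgebraicityLocusCurves)
    rw [HasRingHomProperty.iff_appLE (P := @LocallyOfFinitePresentation)]
    intro U V e'
    haveI := IsLocallyNoetherian.component_noetherian (X := (dualProjectiveSpace N ℂ).left) U
    exact RingHom.FinitePresentation.of_finiteType.mp
      (HasRingHomProperty.appLE @LocallyOfFiniteType _ inferInstance U V e')
  haveI : IsProper π.left := by
    have hgp : IsProper g.left := isProper_sectionFamily_left f e hf
    rw [hπ, familyPullback.snd_left]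
    exact MorphismProperty.pullback_snd (P := @IsProper) _ _ hgp
  haveI : IsIntegral (dualProjectiveSpace N ℂ).left :=
    IsSmoothProjective.isIntegral_holds (isSmoothProjective_projectiveSpace_holds ℂ N)
  -- the smooth locus contains the fibre over the generic point; spread out
  obtain ⟨U, hηU, hU⟩ :=
    Literature.AlgebraicGeometry.Morphisms.exists_smooth_morphismRestrict_of_forall_mem_smoothLocus π.left
      (y := genericPoint (dualProjectiveSpace N ℂ).left)
      (fun y hy => (Scheme.Hom.mem_smoothLocus).mpr (mem_smoothLocus_slicePullback_snd f e t hf hy))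
  haveI := hU
  have hrel : SmoothOfRelativeDimension n (π.left ∣_ U) :=
    smoothOfRelativeDimension_morphismRestrict_of_smooth π (m := N) (k := n) U
  refine ⟨U, ⟨_, hηU⟩, fun H hH => ?_⟩
  haveI := hrel
  have h1 : SmoothOfRelativeDimension n (fiberOver π H).hom := smoothOfRelativeDimension_fiberOver_hom π U H hH
  rw [← map_slice t H]
  have h2 : (fiberOver g (AlgPoints.map σ H)).hom =
      (fiberOverFamilyPullbackIso g σ H).inv.left ≫ (fiberOver π H).hom := by
    rw [Over.w]
  rw [h2]
  haveI := h1
  have h3 : SmoothOfRelativeDimension (0 + n) ((fiberOverFamilyPullbackIso g σ H).inv.left ≫ (fiberOver π H).hom) :=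
    inferInstance
  rwa [Nat.zero_add] at h3

end Slice

/-! ### The slice family maps flatly to the fibre: `𝒴_t = 𝒴 ×_𝒳 X_t ⟶ X_t` -/
section SliceToFibre

variable {n N : ℕ} {𝒳 S : SchemeOver ℂ} (f : 𝒳 ⟶ S) (e : 𝒳 ⟶ projectiveSpace N ℂ) (t : ComplexPoints S)

/-- The fibre square `X_t ⟶ 𝒳`, `X_t ⟶ Spec ℂ`, `f`, `t` is cartesian in `ℂ`-schemes. [folklore] -/
theorem isPullback_fiberι : IsPullback (fiberι f t) (fiberOverToSpec f t) f t :=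
  IsPullback.of_map (Over.forget _) (fiberι_comp f t) (IsPullback.of_hasPullback f.left t.left)

/-- **`𝒴_t ⟶ X_t` is flat.** The slice family `𝒴_t = 𝒴 ×_{S × (ℙᴺ)^*} ({t} × (ℙᴺ)^*)` maps to the
fibre `X_t` by a base change of the smooth `toX : 𝒴 ⟶ 𝒳` (`isPullback_familyPullback_slice` over the
fibre square), hence flatly. [folklore] -/
theorem exists_slicePullback_hom_fiberOver (hf : IsSmoothProjectiveFamily f (n + 1)) [IsAffineHom e.left]
    [Smooth S.hom] [IrreducibleSpace S.left] :
    ∃ v : familyPullback (CartesianMonoidalCategory.lift (toX N e ≫ f) (proj N e))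
        (CartesianMonoidalCategory.lift (toSpecOver (dualProjectiveSpace N ℂ) ≫ t) (𝟙 (dualProjectiveSpace N ℂ))) ⟶
        fiberOver f t,
      v ≫ fiberι f t = familyPullback.fst _ _ ≫ toX N e ∧ Flat v.left := by
  haveI := hf.smoothOfRelativeDimension
  haveI := isIntegral_total_left f hf
  haveI : IsReduced 𝒳.left := inferInstance
  haveI := UniversalHyperplaneSection.smoothOfRelativeDimension_toX_left e
  have sq := IsPullback.of_bot' (isPullback_familyPullback_slice f e t) (isPullback_fiberι f t)
  set v := (isPullback_fiberι f t).lift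
      (familyPullback.fst (CartesianMonoidalCategory.lift (toX N e ≫ f) (proj N e))
        (CartesianMonoidalCategory.lift (toSpecOver (dualProjectiveSpace N ℂ) ≫ t) (𝟙 (dualProjectiveSpace N ℂ))) ≫ toX N e)
      (familyPullback.snd (CartesianMonoidalCategory.lift (toX N e ≫ f) (proj N e))
        (CartesianMonoidalCategory.lift (toSpecOver (dualProjectiveSpace N ℂ) ≫ t) (𝟙 (dualProjectiveSpace N ℂ))) ≫
        toSpecOver (dualProjectiveSpace N ℂ)) (by rw [Category.assoc, (isPullback_familyPullback_slice f e t).w]) with hv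
  refine ⟨v, IsPullback.lift_fst _ _ _ _, ?_⟩
  have h : SmoothOfRelativeDimension (N - 1) v.left := by
    haveI := smoothOfRelativeDimension_isStableUnderBaseChange (n := N - 1)
    exact MorphismProperty.of_isPullback (P := @SmoothOfRelativeDimension (N - 1)) (sq.map (Over.forget _)) ‹_›
  haveI := h
  haveI := SmoothOfRelativeDimension.smooth (N - 1) v.left
  infer_instance

end SliceToFibre

end Literature.AlgebraicGeometry.Motives.SectionFamily

end
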